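import Literature.Computability.Cryptography.IndistinguishabilityObfuscatorSubexp
import Literature.Computability.Complexity.RandomizedProofs
import Literature.Computability.Cryptography.GGM
import Literature.Computability.Complexity.StringSwap

/-!
# `WbwObfuscatedGluedTrees` (stmt-QuantumAdvantage-2340) — VI-a: coin padding and the seed-budget coin clause (definition-free core)

Support / negative lemmas for the INFORMAL crux `WbwObfuscatedGluedTrees` of route
`Summits/QuantumAdvantage/QuantumAdvantage/Theses/WhiteBoxWalk`, line `knowledge-of-walk-split`, extracted
from the refuter work file `Summits/QuantumAdvantage/QuantumAdvantage/Cruxes/WbwObfuscatedGluedTrees/Disproof.lean`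
§6 (cycle 3) and filed in cycle 4 (refuter-cdisprove-stmt-QuantumAdvantage-2340-g4-0). Sorry-free, and free
of definitions (pure theorems about the tree's `CircuitObfuscator` / `IsSubexpIO` / `uniformProb`); no Theses
decl is asserted.

1. **Coin padding** (`isEfficient_padCoin`, `isSubexpIO_padCoin`, `subexpIOExist_iff_pos_coins`): for every
   obfuscator `O`, the obfuscator `⟨fun κ C r => O.obf κ C r.dropLast, fun ℓ => O.coinLen ℓ + 1⟩` ("one extra,
   ignored last coin") has the SAME obfuscation law (`obfPMF_padCoin`: `U_{c+1}` minus its last bit is `U_c`),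
   hence the same functionality, slowdown and `(t,δ)`-security, and it is efficient when `O` is; so
   `SubexpIOExist ε ↔ ∃ O, IsSubexpIO ε ppolyCircuits O ∧ ∀ ℓ, 1 ≤ O.coinLen ℓ` — "w.l.o.g. an iO tosses a
   coin on every input" is a theorem of the tree's model.
2. **The POINTWISE seed-budget coin clause is unsatisfiable for coin-tossing obfuscators**
   (`coinClause_unsatisfiable_of_coinLen_pos`): the hypothesis
   `∀ s, O.coins (κ |s|) (C (s ↾ h |s|)) ≤ |s| − h |s|` of the SUPERSEDED stubs `stub_bestPossibleStep` /
   `stub_obfuscationMonotone` (skeleton sha `17df6c6a…` of `Cruxes/WbwObfuscatedGluedTrees/Lines/knowledge-of-walk-split.lean`,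
   replaced 2026-08-16T05:20Z by the EVENTUAL clause `∃ n₀, ∀ s, n₀ ≤ |s| → …`) forces at `s = []` a zero coin
   budget at an input length `≥ 2`; with 1.: for every sub-exp iO there is a sub-exp iO with the same law for which
   the clause fails for ALL schedules `κ h m C` (`exists_subexpIO_pointwise_coinClause_false`) — the stubs were
   vacuous for it, and no `O`-independent datum can serve every sub-exp iO. The companion file
   `CoinDiscipline.lean` (VI-b) draws the consequence for the superseded bridge (`hadm ⇒ CruxShape`).
3. **Prefix hits** (`uniformProb_prefix_le`): over a uniform `w ∈ {0,1}^L`, a FIXED string `y` has `w` as a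
   prefix with probability `≤ 2^{-L}` — the information-theoretic half of the padding witness of Disproof §6
   (T-a) against `stub_bestPossibleStep` WITHOUT a length bound on names / answers (repair adopted: poly bounds).
-/

set_option linter.dupNamespace false

namespace Summit.QuantumAdvantage.QuantumAdvantage.Theorems.WbwObfuscatedGluedTrees.Negative

open Literature.Computability.Cryptography Literature.Computability.Complexity
open Literature.Computability.QuantumComplexity
open Filter Asymptotics

namespace CoinPad

/-! ## 1. Coin padding -/

variable (O : CircuitObfuscator)

/-- `coins` of the padded obfuscator `⟨obf ∘ dropLast, coinLen + 1⟩`. [folklore] -/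
theorem coins_padCoin (κ : ℕ) {n : ℕ} (C : Circuit (Fin n)) :
    (⟨fun κ {_} C r => O.obf κ C r.dropLast, fun ℓ => O.coinLen ℓ + 1⟩ : CircuitObfuscator).coins κ C =
      O.coins κ C + 1 := rfl

/-- **Same obfuscation law** (`U_{c+1}` without its last bit is `U_c`). [folklore] -/
theorem obfPMF_padCoin (κ : ℕ) {n : ℕ} (C : Circuit (Fin n)) :
    (⟨fun κ {_} C r => O.obf κ C r.dropLast, fun ℓ => O.coinLen ℓ + 1⟩ : CircuitObfuscator).obfPMF κ C =
      O.obfPMF κ C := by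
  unfold CircuitObfuscator.obfPMF
  rw [coins_padCoin]
  show (uniformBits (O.coins κ C + 1)).map ((O.obf κ C) ∘ List.dropLast) = _
  rw [← PMF.map_comp, PRGTrunc.uniformBits_succ_map_dropLast]

/-- Same law of the obfuscated CODE. [folklore] -/
theorem obfCodePMF_padCoin (κ : ℕ) {n : ℕ} (C : Circuit (Fin n)) :
    (⟨fun κ {_} C r => O.obf κ C r.dropLast, fun ℓ => O.coinLen ℓ + 1⟩ : CircuitObfuscator).obfCodePMF κ C =
      O.obfCodePMF κ C := by
  unfold CircuitObfuscator.obfCodePMF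
  rw [obfPMF_padCoin]

/-- Same distinguishing advantages (with advice). [folklore] -/
theorem ioAdvantageAdv_padCoin (D : RandAlg (List Bool) Bool) (a : ℕ → List Bool) (κ : ℕ) {n : ℕ}
    (C₀ C₁ : Circuit (Fin n)) :
    (⟨fun κ {_} C r => O.obf κ C r.dropLast, fun ℓ => O.coinLen ℓ + 1⟩ : CircuitObfuscator).ioAdvantageAdv
        D a κ C₀ C₁ = O.ioAdvantageAdv D a κ C₀ C₁ := by
  unfold CircuitObfuscator.ioAdvantageAdv
  rw [obfCodePMF_padCoin, obfCodePMF_padCoin]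

/-- Coin padding preserves perfect functionality. [folklore] -/
theorem preservesFunctionality_padCoin {𝒞 : ℕ → Set SizedCircuit} (h : O.PreservesFunctionality 𝒞) :
    (⟨fun κ {_} C r => O.obf κ C r.dropLast, fun ℓ => O.coinLen ℓ + 1⟩ :
      CircuitObfuscator).PreservesFunctionality 𝒞 := by
  intro κ n C hC C' hC'
  rw [obfPMF_padCoin] at hC'
  exact h κ n C hC C' hC'

/-- Coin padding preserves polynomial slowdown. [folklore] -/
theorem hasPolySlowdown_padCoin {𝒞 : ℕ → Set SizedCircuit} (h : O.HasPolySlowdown 𝒞) :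
    (⟨fun κ {_} C r => O.obf κ C r.dropLast, fun ℓ => O.coinLen ℓ + 1⟩ :
      CircuitObfuscator).HasPolySlowdown 𝒞 := by
  obtain ⟨p, hp⟩ := h
  refine ⟨p, fun κ n C hC C' hC' => ?_⟩
  rw [obfPMF_padCoin] at hC'
  exact hp κ n C hC C' hC'

/-- Coin padding preserves `(t,δ)`-indistinguishability. [folklore] -/
theorem isSecureIndistinguishable_padCoin {t δ : ℕ → ℝ} {𝒞 : ℕ → Set SizedCircuit}
    (h : O.IsSecureIndistinguishable t δ 𝒞) :
    (⟨fun κ {_} C r => O.obf κ C r.dropLast, fun ℓ => O.coinLen ℓ + 1⟩ :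
      CircuitObfuscator).IsSecureIndistinguishable t δ 𝒞 := by
  intro D hD a ha
  filter_upwards [h D hD a ha] with κ hκ n C₀ C₁ h₀ h₁ hs he
  rw [ioAdvantageAdv_padCoin]
  exact hκ n C₀ C₁ h₀ h₁ hs he

/-- **The padded obfuscator is efficient**: `O`'s machine after the polynomial-time preprocessing
`⟨u, r⟩ ↦ ⟨u, r.dropLast⟩` (`mapSndFn dropLast ∈ FP`, transported along the input encoding;
`PolyTimeComputable.comp_holds`); coin budget bounded by `p + 1`. [folklore] -/
theorem isEfficient_padCoin (h : O.IsEfficient) :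
    (⟨fun κ {_} C r => O.obf κ C r.dropLast, fun ℓ => O.coinLen ℓ + 1⟩ : CircuitObfuscator).IsEfficient := by
  obtain ⟨hrun, p, hp⟩ := h
  refine ⟨?_, p + 1, fun ℓ => ?_⟩
  · have hpre : PolyTimeComputable
        (fun pr : (ℕ × SizedCircuit) × List Bool => boolPair (CircuitObfuscator.encodeInput pr.1) pr.2)
        (fun pr : (ℕ × SizedCircuit) × List Bool => boolPair (CircuitObfuscator.encodeInput pr.1) pr.2)
        (fun pr : (ℕ × SizedCircuit) × List Bool => (pr.1, pr.2.dropLast)) :=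
      PolyTimeComputable.of_encode_eq (f := mapSndFn fun l : List Bool => l.dropLast)
        (fun pr : (ℕ × SizedCircuit) × List Bool => boolPair (CircuitObfuscator.encodeInput pr.1) pr.2)
        (fun _ => rfl) (fun pr => by simp) (mapSndFn_mem_FP PRGTrunc.dropLast_mem_FP)
    have hcomp := PolyTimeComputable.comp_holds hrun hpre
    have heq : (Function.uncurry O.toRandAlg.run) ∘
        (fun pr : (ℕ × SizedCircuit) × List Bool => (pr.1, pr.2.dropLast)) =
        Function.uncurry (⟨fun κ {_} C r => O.obf κ C r.dropLast, fun ℓ => O.coinLen ℓ + 1⟩ :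
          CircuitObfuscator).toRandAlg.run := by
      funext pr
      rfl
    rw [heq] at hcomp
    exact hcomp
  · show O.coinLen ℓ + 1 ≤ (p + 1).eval ℓ
    rw [Polynomial.eval_add, Polynomial.eval_one]
    exact Nat.add_le_add_right (hp ℓ) 1

/-- **Coin padding preserves sub-exponential iO security** (any class, any `ε`). [folklore] -/
theorem isSubexpIO_padCoin {ε : ℝ} {𝒞 : ℕ → Set SizedCircuit} (h : IsSubexpIO ε 𝒞 O) :
    IsSubexpIO ε 𝒞 (⟨fun κ {_} C r => O.obf κ C r.dropLast, fun ℓ => O.coinLen ℓ + 1⟩ : CircuitObfuscator) :=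
  ⟨isEfficient_padCoin O h.isEfficient, preservesFunctionality_padCoin O h.preserves,
    hasPolySlowdown_padCoin O h.slowdown, isSecureIndistinguishable_padCoin O h.indist⟩

/-- **W.l.o.g. an iO tosses a coin**: every `(t,δ)`-sub-exp iO has a companion with the same obfuscation law,
the same security, and everywhere-positive coin budget. [folklore] -/
theorem exists_isSubexpIO_pos_coins {ε : ℝ} {𝒞 : ℕ → Set SizedCircuit} (h : IsSubexpIO ε 𝒞 O) :
    ∃ O' : CircuitObfuscator, IsSubexpIO ε 𝒞 O' ∧ (∀ ℓ, 1 ≤ O'.coinLen ℓ) ∧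
      ∀ (κ n : ℕ) (C : Circuit (Fin n)), O'.obfPMF κ C = O.obfPMF κ C :=
  ⟨_, isSubexpIO_padCoin O h, fun _ => Nat.succ_pos _, fun κ _ C => obfPMF_padCoin O κ C⟩

/-- **A sub-exp iO for `P/poly` exists iff one with everywhere-positive coin budget exists.** [folklore] -/
theorem subexpIOExist_iff_pos_coins (ε : ℝ) :
    SubexpIOExist ε ↔ ∃ O, IsSubexpIO ε ppolyCircuits O ∧ ∀ ℓ, 1 ≤ O.coinLen ℓ := by
  constructor
  · rintro ⟨O, hO⟩
    obtain ⟨O', h', hpos, -⟩ := exists_isSubexpIO_pos_coins O hO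
    exact ⟨O', h', hpos⟩
  · rintro ⟨O, hO, -⟩
    exact ⟨O, hO⟩

/-! ## 2. The pointwise seed-budget coin clause -/

/-- The encoded obfuscator input `⟨1^κ, ⟨bin n, code C⟩⟩` is never shorter than `2` (the pairing
separator). [folklore] -/
theorem two_le_length_encodeInput (κ : ℕ) (C : SizedCircuit) :
    2 ≤ (CircuitObfuscator.encodeInput (κ, C)).length := by
  unfold CircuitObfuscator.encodeInput
  rw [length_boolPair]
  omega

/-- **The pointwise clause forces a zero coin budget at the empty seed.** [folklore] -/
theorem coins_zero_of_pointwise_coinClause (κ h : ℕ → ℕ) (m : List Bool → ℕ)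
    (C : (k : List Bool) → Circuit (Fin (m k)))
    (hs : ∀ s : List Bool, O.coins (κ s.length) (C (s.take (h s.length))) ≤ s.length - h s.length) :
    O.coins (κ 0) (C (List.take (h 0) [])) = 0 := by
  have h0 := hs []
  simp only [List.length_nil, Nat.zero_sub, Nat.le_zero] at h0
  exact h0

/-- **The pointwise coin hypothesis of the superseded `stub_bestPossibleStep` / `stub_obfuscationMonotone`
is unsatisfiable for every obfuscator with everywhere-positive coin budget** (whatever `κ h m C`): for such `O`
both stubs held VACUOUSLY. [folklore] -/
theorem coinClause_unsatisfiable_of_coinLen_pos (hO : ∀ ℓ, 2 ≤ ℓ → 1 ≤ O.coinLen ℓ) (κ h : ℕ → ℕ)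
    (m : List Bool → ℕ) (C : (k : List Bool) → Circuit (Fin (m k))) :
    ¬ (∀ s : List Bool, O.coins (κ s.length) (C (s.take (h s.length))) ≤ s.length - h s.length) := by
  intro hs
  have h0 := coins_zero_of_pointwise_coinClause O κ h m C hs
  unfold CircuitObfuscator.coins at h0
  have := hO _ (two_le_length_encodeInput (κ 0) ⟨_, C (List.take (h 0) [])⟩)
  omega

/-- **No schedule serves every sub-exp iO under the pointwise clause**: for every sub-exp iO `O` there is a
sub-exp iO `O'` with the SAME obfuscation law for which the pointwise clause fails for ALL `κ h m C`. (So a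
bridge demanding an `O`-independent datum admissible for every sub-exp iO was vacuous; see VI-b.) [folklore] -/
theorem exists_subexpIO_pointwise_coinClause_false {ε : ℝ} {𝒞 : ℕ → Set SizedCircuit}
    (h : IsSubexpIO ε 𝒞 O) :
    ∃ O' : CircuitObfuscator, IsSubexpIO ε 𝒞 O' ∧
      (∀ (κ n : ℕ) (C : Circuit (Fin n)), O'.obfPMF κ C = O.obfPMF κ C) ∧
      ∀ (κ h : ℕ → ℕ) (m : List Bool → ℕ) (C : (k : List Bool) → Circuit (Fin (m k))),
        ¬ (∀ s : List Bool, O'.coins (κ s.length) (C (s.take (h s.length))) ≤ s.length - h s.length) := by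
  obtain ⟨O', h', hpos, hlaw⟩ := exists_isSubexpIO_pos_coins O h
  exact ⟨O', h', hlaw, fun κ hh m C => coinClause_unsatisfiable_of_coinLen_pos O' (fun ℓ _ => hpos ℓ) κ hh m C⟩

/-- **For an obfuscator using at least `κ` coins at security level `κ`** (every candidate in print), the
pointwise clause forces a SUB-LINEAR security parameter `κ n ≤ n − h n` at EVERY seed length (cycle-1 trap T2,
seed budget). [folklore] -/
theorem kappa_le_of_pointwise_coinClause (hO : ∀ (κ n : ℕ) (C : Circuit (Fin n)), κ ≤ O.coins κ C)
    (κ h : ℕ → ℕ) (m : List Bool → ℕ) (C : (k : List Bool) → Circuit (Fin (m k)))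
    (hs : ∀ s : List Bool, O.coins (κ s.length) (C (s.take (h s.length))) ≤ s.length - h s.length)
    (s : List Bool) : κ s.length ≤ s.length - h s.length :=
  (hO _ _ _).trans (hs s)

end CoinPad

/-! ## 3. Prefix hits: the information-theoretic half of the padding witness (Disproof §6 (T-a)) -/

namespace Padding

/-- At most one string of a given length is a prefix of a given string. [folklore] -/
theorem prefix_unique_of_length_eq {w w' y : List Bool} (hw : w <+: y) (hw' : w' <+: y)
    (hlen : w.length = w'.length) : w = w' := by
  rw [List.prefix_iff_eq_take] at hw hw'
  rw [hw, hw', hlen]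

/-- **The candidate answers hitting a fixed output form a set of size `≤ 1`** (among all strings of
length `L`). [folklore] -/
theorem prefix_hit_card_le_one (L : ℕ) (y : List Bool) :
    (Finset.univ.filter fun w : List.Vector Bool L => w.toList <+: y).card ≤ 1 := by
  rw [Finset.card_le_one]
  intro a ha b hb
  rw [Finset.mem_filter] at ha hb
  have := prefix_unique_of_length_eq ha.2 hb.2 (by simp)
  exact List.Vector.toList_injective this

/-- Hence the uniform probability, over the answer `w ∈ {0,1}^L`, that `w` is a prefix of a FIXED output
`y` is at most `2^{-L}` — for every (even unbounded) adversary whose view is independent of `w`.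
[folklore] -/
theorem uniformProb_prefix_le (L : ℕ) (y : List Bool) :
    uniformProb L {w | w <+: y} ≤ 1 / 2 ^ L := by
  unfold uniformProb
  rw [div_le_div_iff_of_pos_right (by positivity), Nat.cast_le_one, Finset.card_le_one]
  intro a ha b hb
  simp only [Finset.mem_filter, Finset.mem_univ, true_and, Set.mem_setOf_eq] at ha hb
  exact List.Vector.toList_injective (prefix_unique_of_length_eq ha hb (by simp))

end Padding

end Summit.QuantumAdvantage.QuantumAdvantage.Theorems.WbwObfuscatedGluedTrees.Negative
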